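import Mathlib
import HarnessLib
import Literature.Probability.LatticeModels.LeeYangFirstZeroMonotoneProofs
import Literature.Probability.LatticeModels.UrsellFirstZeroFromCurrents
import Literature.Probability.LatticeModels.ThermodynamicLimit

/-!
# A Lee–Yang zero of the free cube forces one in every larger free box (stub `stub_cubeZeroToFreeBox`)

Route `LeeYangGap` (Ising3DConformalLimit), crux `NearCriticalLeeYangGap`
(item stmt-CriticalPhenomena-4945), line `registered`, stub S1v `stub_cubeZeroToFreeBox`.

Nearest-neighbour Ising model on `ℤ³`, free boundary condition, zero field; `Λ_L = box 3 L`,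
`M_L = ∑_{x ∈ Λ_L} σ_x`, `φ^free_{N,L,β}(t) = ⟨cos(t M_L)⟩^free_{Λ_N;β,0}` (`L ≤ N`).

**Claim.** If `θ > 0` is a zero of the cube's own characteristic function `φ^free_{L,L,β}`
(`0 ≤ β`), then for every `N ≥ L` the function `φ^free_{N,L,β}` has a zero `t ∈ (0, θ]`.

**Proof.** Camia–Jiang–Newman 2023, Theorem 2 (the first Lee–Yang zero of
`⟨exp[h ∑ λ_u σ_u]⟩_{G,J}` is non-increasing in each coupling `J_{uv}`; tree theorem
`CamiaJiangNewman2023_thm2_holds`, zero form over `PairIsing.mgf`) applied IN THE VOLUME: on the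
index set `↥Λ_N` take the weights `λ = 𝟙_{Λ_L}` and compare the couplings
`c = β/2·𝟙{a ∼ b, a, b ∈ Λ_L}` (only the bonds of the cube) with `c' = β/2·𝟙{a ∼ b}` (all bonds of
`Λ_N`), `0 ≤ c ≤ c'`. The one new identity is the DECOUPLING
`⟨cos(θ X_λ)⟩_c = ⟨cos(θ M_L)⟩^free_{Λ_L;β,0}`: with couplings and weights supported in `Λ_L` both
the Boltzmann weight and the observable depend only on the restriction of the configuration to
`Λ_L`, so numerator and denominator of the `c`-average factor through the restriction map
`(↥Λ_N → ℤˣ) ≃ (↥Λ_L → ℤˣ) × (↥(Λ_N ∖ Λ_L) → ℤˣ)` with the common factor `2^{|Λ_N ∖ Λ_L|}`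
(`sum_spinConfig_restrict_eq`, `weight_blockCoupling_eq`, `weightedMagnetization_block_eq`), and the
`Λ_L`-average is the cube expectation by the tree's dictionary `isingExpect_cos_eq_avg`. Hence the
cube zero `θ` is the zero `iθ` of `mgf_c` (`PairIsing.mgf_mul_I`); Thm 2 gives a zero `h'` of
`mgf_{c'}` with `‖h'‖ ≤ θ`; by the generalised Lee–Yang theorem it is `±it`, `t ∈ (0, ‖h'‖]` a zero of
`⟨cos(t X_λ)⟩_{c'}` (`PairIsing.exists_cos_zero_of_mgf_eq_zero`), which is `φ^free_{N,L,β}(t)` by the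
dictionary again (`box_mono`).

## References

* [CamiaJiangNewman2023] F. Camia, J. Jiang, C. M. Newman, *Monotonicity of Ursell functions in the
  Ising model*, CMP 401 (2023) 2459–2482, arXiv:2207.12247: Thm 2, Cor 1 and §1.2.
* [FriedliVelenik2017] S. Friedli, Y. Velenik, *Statistical Mechanics of Lattice Systems*, CUP 2017,
  §3.1 eq. (3.8) (the free box as a finite Gibbs average).
-/

noncomputable section

namespace Summit.CriticalPhenomena.Ising3DConformalLimit.LeeYangGapNearCriticalLeeYangGap

open Literature.Probability.LatticeModels Finset Complex

/-! ### Decoupling: a pair model whose couplings live inside `B ⊆ Λ` is the model on `B` -/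

section Decoupling

variable {V : Type*} [DecidableEq V]

/-- **Splitting configurations along `B ⊆ Λ`.** A sum over the configurations of `Λ` of a function
of their restriction to `B` is `|{configurations of Λ ∖ B}|` times the sum over the configurations
of `B` (the restriction map `(↥Λ → ℤˣ) ≃ (↥B → ℤˣ) × (↥(Λ ∖ B) → ℤˣ)`). [folklore] -/
theorem sum_spinConfig_restrict_eq {Λ B : Finset V} (hBΛ : B ⊆ Λ) (H : SpinConfig ↥B → ℝ) :
    ∑ ρ : SpinConfig ↥Λ, H (fun b : ↥B => ρ ⟨b, hBΛ b.2⟩) =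
      (Fintype.card (SpinConfig ↥(Λ \ B)) : ℝ) * ∑ τ : SpinConfig ↥B, H τ := by
  let E : SpinConfig ↥Λ ≃ SpinConfig ↥B × SpinConfig ↥(Λ \ B) :=
    { toFun := fun ρ => (fun b => ρ ⟨b, hBΛ b.2⟩, fun d => ρ ⟨d, (Finset.mem_sdiff.1 d.2).1⟩)
      invFun := fun p a => if h : (a : V) ∈ B then p.1 ⟨a, h⟩
        else p.2 ⟨a, Finset.mem_sdiff.2 ⟨a.2, h⟩⟩
      left_inv := fun ρ => by
        funext a
        dsimp only
        split_ifs <;> rfl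
      right_inv := fun p => by
        refine Prod.ext (funext fun b => ?_) (funext fun d => ?_)
        · dsimp only
          rw [dif_pos b.2]
        · dsimp only
          rw [dif_neg (Finset.mem_sdiff.1 d.2).2] }
  rw [Fintype.sum_equiv E (fun ρ => H (fun b : ↥B => ρ ⟨b, hBΛ b.2⟩)) (fun p => H p.1)
    (fun ρ => rfl), Fintype.sum_prod_type]
  simp only [Finset.sum_const, Finset.card_univ, nsmul_eq_mul]
  rw [← Finset.mul_sum]

variable (G : SimpleGraph V) [DecidableRel G.Adj]

/-- **The Boltzmann weight of the cube's bonds inside a larger box.** With couplings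
`β/2·𝟙{a ∼ b, a, b ∈ B}` on `↥Λ` the pair-interaction weight of a configuration of `Λ` is the weight,
for the couplings `β/2·𝟙{a ∼ b}` on `↥B`, of its restriction to `B`. [folklore] -/
theorem weight_blockCoupling_eq {Λ B : Finset V} (hBΛ : B ⊆ Λ) (β : ℝ) (ρ : SpinConfig ↥Λ) :
    PairIsing.weight
        (fun a b : ↥Λ => if G.Adj a b ∧ (a : V) ∈ B ∧ (b : V) ∈ B then β / 2 else 0) ρ =
      PairIsing.weight (fun a b : ↥B => if G.Adj a b then β / 2 else 0)
        (fun b : ↥B => ρ ⟨b, hBΛ b.2⟩) := by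
  unfold PairIsing.weight
  congr 1
  set σ : SpinConfig V := glue Λ ρ .free with hσ
  have hs : ∀ a : ↥Λ, spinAt a ρ = spinAt (a : V) σ := by
    intro a; simp [spinAt, hσ]
  have hsB : ∀ b : ↥B, spinAt b (fun b : ↥B => ρ ⟨b, hBΛ b.2⟩) = spinAt (b : V) σ := by
    intro b; simp [spinAt, hσ, glue_apply_of_mem Λ ρ _ (hBΛ b.2)]
  simp_rw [hs, hsB]
  set g : V → V → ℝ := fun x y =>
    (if G.Adj x y ∧ x ∈ B ∧ y ∈ B then β / 2 else 0) * (spinAt x σ * spinAt y σ) with hg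
  set g' : V → V → ℝ := fun x y =>
    (if G.Adj x y then β / 2 else 0) * (spinAt x σ * spinAt y σ) with hg'
  calc ∑ a : ↥Λ, ∑ b : ↥Λ, g a b
      = ∑ a : ↥Λ, ∑ y ∈ Λ, g a y := Finset.sum_congr rfl fun a _ => Finset.sum_coe_sort Λ (g a)
    _ = ∑ x ∈ Λ, ∑ y ∈ Λ, g x y := Finset.sum_coe_sort Λ (fun x => ∑ y ∈ Λ, g x y)
    _ = ∑ x ∈ B, ∑ y ∈ B, g x y := by
        symm
        calc ∑ x ∈ B, ∑ y ∈ B, g x y = ∑ x ∈ B, ∑ y ∈ Λ, g x y :=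
              Finset.sum_congr rfl fun x _ =>
                Finset.sum_subset hBΛ fun y _ hy => by simp [hg, hy]
          _ = ∑ x ∈ Λ, ∑ y ∈ Λ, g x y :=
              Finset.sum_subset hBΛ fun x _ hx => Finset.sum_eq_zero fun y _ => by simp [hg, hx]
    _ = ∑ x ∈ B, ∑ y ∈ B, g' x y :=
        Finset.sum_congr rfl fun x hx => Finset.sum_congr rfl fun y hy => by
          simp [hg, hg', hx, hy]
    _ = ∑ a : ↥B, ∑ y ∈ B, g' a y := (Finset.sum_coe_sort B (fun x => ∑ y ∈ B, g' x y)).symm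
    _ = ∑ a : ↥B, ∑ b : ↥B, g' a b :=
        Finset.sum_congr rfl fun a _ => (Finset.sum_coe_sort B (g' a)).symm

/-- **The block magnetisation read inside a larger box.** `X_{𝟙_B}` of a configuration of `Λ ⊇ B` is
`X_{𝟙_B}` of its restriction to `B`. [folklore] -/
theorem weightedMagnetization_block_eq {Λ B : Finset V} (hBΛ : B ⊆ Λ) (ρ : SpinConfig ↥Λ) :
    PairIsing.weightedMagnetization (fun a : ↥Λ => if (a : V) ∈ B then (1 : ℝ) else 0) ρ =
      PairIsing.weightedMagnetization (fun b : ↥B => if (b : V) ∈ B then (1 : ℝ) else 0)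
        (fun b : ↥B => ρ ⟨b, hBΛ b.2⟩) := by
  unfold PairIsing.weightedMagnetization
  set σ : SpinConfig V := glue Λ ρ .free with hσ
  have hs : ∀ a : ↥Λ, spinAt a ρ = spinAt (a : V) σ := by
    intro a; simp [spinAt, hσ]
  have hsB : ∀ b : ↥B, spinAt b (fun b : ↥B => ρ ⟨b, hBΛ b.2⟩) = spinAt (b : V) σ := by
    intro b; simp [spinAt, hσ, glue_apply_of_mem Λ ρ _ (hBΛ b.2)]
  simp_rw [hs, hsB]
  have hΛ : ∑ a : ↥Λ, (if (a : V) ∈ B then (1 : ℝ) else 0) * spinAt (a : V) σ =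
      ∑ x ∈ Λ, (if x ∈ B then (1 : ℝ) else 0) * spinAt x σ :=
    Finset.sum_coe_sort Λ (fun x => (if x ∈ B then (1 : ℝ) else 0) * spinAt x σ)
  have hB : ∑ b : ↥B, (if (b : V) ∈ B then (1 : ℝ) else 0) * spinAt (b : V) σ =
      ∑ x ∈ B, (if x ∈ B then (1 : ℝ) else 0) * spinAt x σ :=
    Finset.sum_coe_sort B (fun x => (if x ∈ B then (1 : ℝ) else 0) * spinAt x σ)
  rw [hΛ, hB]
  simp_rw [ite_mul, zero_mul, one_mul]
  rw [Finset.sum_ite_mem, Finset.sum_ite_mem, Finset.inter_eq_right.2 hBΛ, Finset.inter_self]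

variable [G.LocallyFinite]

/-- **Decoupling.** The `PairIsing` average, with the cube's couplings `β/2·𝟙{a ∼ b, a, b ∈ B}` on
`↥Λ`, of `cos(θ X_{𝟙_B})` is the free-boundary, zero-field cube expectation
`⟨cos(θ ∑_{x ∈ B} σ_x)⟩^free_{B;β,0}`: the spins of `Λ ∖ B` are free and factor off.
[cite: FriedliVelenik2017, §3.1, eq. (3.8)] -/
theorem avg_blockCoupling_cos_eq_isingExpect {Λ B : Finset V} (hBΛ : B ⊆ Λ) (β θ : ℝ) :
    PairIsing.avg (fun a b : ↥Λ => if G.Adj a b ∧ (a : V) ∈ B ∧ (b : V) ∈ B then β / 2 else 0)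
        (fun ρ => Real.cos (θ * PairIsing.weightedMagnetization
          (fun a : ↥Λ => if (a : V) ∈ B then (1 : ℝ) else 0) ρ)) =
      isingExpect G B β 0 .free (fun σ => Real.cos (θ * ∑ x ∈ B, spinAt x σ)) := by
  -- the cube side, by the dictionary with `Λ := B`, `λ ≡ 1`
  have hdict := isingExpect_cos_eq_avg G (Finset.Subset.refl B) (fun _ => (1 : ℝ)) β θ
  simp only [one_mul] at hdict
  rw [hdict, PairIsing.avg_def, PairIsing.avg_def]
  have hK : (Fintype.card (SpinConfig ↥(Λ \ B)) : ℝ) ≠ 0 := Nat.cast_ne_zero.2 Fintype.card_ne_zero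
  have hnum : ∑ ρ : SpinConfig ↥Λ, Real.cos (θ * PairIsing.weightedMagnetization
        (fun a : ↥Λ => if (a : V) ∈ B then (1 : ℝ) else 0) ρ) *
        PairIsing.weight
          (fun a b : ↥Λ => if G.Adj a b ∧ (a : V) ∈ B ∧ (b : V) ∈ B then β / 2 else 0) ρ =
      (Fintype.card (SpinConfig ↥(Λ \ B)) : ℝ) *
        ∑ τ : SpinConfig ↥B, Real.cos (θ * PairIsing.weightedMagnetization
          (fun b : ↥B => if (b : V) ∈ B then (1 : ℝ) else 0) τ) *
          PairIsing.weight (fun a b : ↥B => if G.Adj a b then β / 2 else 0) τ := by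
    rw [← sum_spinConfig_restrict_eq hBΛ]
    exact Fintype.sum_congr _ _ fun ρ => by
      rw [weightedMagnetization_block_eq hBΛ ρ, weight_blockCoupling_eq G hBΛ β ρ]
  have hden : ∑ ρ : SpinConfig ↥Λ, PairIsing.weight
        (fun a b : ↥Λ => if G.Adj a b ∧ (a : V) ∈ B ∧ (b : V) ∈ B then β / 2 else 0) ρ =
      (Fintype.card (SpinConfig ↥(Λ \ B)) : ℝ) *
        ∑ τ : SpinConfig ↥B, PairIsing.weight (fun a b : ↥B => if G.Adj a b then β / 2 else 0) τ := by
    rw [← sum_spinConfig_restrict_eq hBΛ]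
    exact Fintype.sum_congr _ _ fun ρ => weight_blockCoupling_eq G hBΛ β ρ
  rw [hnum, hden, mul_div_mul_left _ _ hK]

end Decoupling

/-! ### Camia–Jiang–Newman Theorem 2 in the volume -/

/-- **A zero of the block's own free expectation forces a zero in every larger free volume.** For a
locally finite graph `G`, finite volumes `B ⊆ Λ`, `0 ≤ β` and a zero `θ > 0` of
`θ ↦ ⟨cos(θ ∑_{x∈B} σ_x)⟩^free_{B;β,0}`, the function `t ↦ ⟨cos(t ∑_{x∈B} σ_x)⟩^free_{Λ;β,0}` has a
zero `t ∈ (0, θ]`: Camia–Jiang–Newman 2023 Thm 2 on `↥Λ` for the weights `𝟙_B` and the couplings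
`β/2·𝟙{a ∼ b, a, b ∈ B} ≤ β/2·𝟙{a ∼ b}`, the smaller model being the block's by decoupling.
[cite: CamiaJiangNewman2023, Thm 2, Cor 1 and proof of Thm 2 (§1.2, p. 4)] -/
theorem exists_zero_isingExpect_cos_of_subset {V : Type} [DecidableEq V] (G : SimpleGraph V)
    [DecidableRel G.Adj] [G.LocallyFinite] {Λ B : Finset V} (hBΛ : B ⊆ Λ) {β θ : ℝ} (hβ : 0 ≤ β)
    (hθ : 0 < θ)
    (hzero : isingExpect G B β 0 .free (fun σ => Real.cos (θ * ∑ x ∈ B, spinAt x σ)) = 0) :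
    ∃ t : ℝ, 0 < t ∧ t ≤ θ ∧
      isingExpect G Λ β 0 .free (fun σ => Real.cos (t * ∑ x ∈ B, spinAt x σ)) = 0 := by
  -- couplings `β/2·𝟙{a ∼ b, a, b ∈ B} ≤ β/2·𝟙{a ∼ b}` and weights `𝟙_B ≥ 0` on `↥Λ`
  have hc : ∀ a b : ↥Λ,
      0 ≤ (if G.Adj a b ∧ (a : V) ∈ B ∧ (b : V) ∈ B then β / 2 else (0 : ℝ)) := fun a b => by
    split_ifs <;> linarith
  have hcc' : ∀ a b : ↥Λ, (if G.Adj a b ∧ (a : V) ∈ B ∧ (b : V) ∈ B then β / 2 else (0 : ℝ)) ≤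
      (if G.Adj a b then β / 2 else (0 : ℝ)) := fun a b => by
    by_cases h : G.Adj a b
    · rw [if_pos h]
      split_ifs <;> linarith
    · rw [if_neg h, if_neg fun h' => h h'.1]
  have hc' : ∀ a b : ↥Λ, 0 ≤ (if G.Adj a b then β / 2 else (0 : ℝ)) :=
    fun a b => (hc a b).trans (hcc' a b)
  have hlam : ∀ a : ↥Λ, 0 ≤ (if (a : V) ∈ B then (1 : ℝ) else 0) := fun a => by
    split_ifs <;> norm_num
  -- the zero `iθ` of the mgf of the block's couplings, by decoupling
  have hz : PairIsing.mgf
      (fun a b : ↥Λ => if G.Adj a b ∧ (a : V) ∈ B ∧ (b : V) ∈ B then β / 2 else 0)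
      (fun a : ↥Λ => if (a : V) ∈ B then (1 : ℝ) else 0) (θ * I) = 0 := by
    rw [PairIsing.mgf_mul_I, avg_blockCoupling_cos_eq_isingExpect G hBΛ β θ, hzero, ofReal_zero]
  -- CJN Thm 2 (zero form, proved in the tree): a zero of the `Λ`-mgf of modulus `≤ θ`
  obtain ⟨h', hh', hnorm⟩ := CamiaJiangNewman2023_thm2_holds (↥Λ)
    (fun a b : ↥Λ => if G.Adj a b ∧ (a : V) ∈ B ∧ (b : V) ∈ B then β / 2 else 0)
    (fun a b : ↥Λ => if G.Adj a b then β / 2 else 0)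
    (fun a : ↥Λ => if (a : V) ∈ B then (1 : ℝ) else 0) hc hcc' hlam (θ * I) hz
  -- Lee–Yang: it is `±it` with `t` a real zero of `⟨cos tX⟩_{c'}`
  obtain ⟨t, htpos, htle, hcos⟩ :=
    PairIsing.exists_cos_zero_of_mgf_eq_zero (c := fun a b : ↥Λ => if G.Adj a b then β / 2 else 0)
      (lam := fun a : ↥Λ => if (a : V) ∈ B then (1 : ℝ) else 0) hc' hlam hh'
  refine ⟨t, htpos, ?_, ?_⟩
  · calc t ≤ ‖h'‖ := htle
      _ ≤ ‖(θ : ℂ) * I‖ := hnorm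
      _ = θ := by simp [abs_of_pos hθ]
  · have hdict := isingExpect_cos_eq_avg G hBΛ (fun _ => (1 : ℝ)) β t
    simp only [one_mul] at hdict
    rw [hdict]
    exact hcos

/-- **S1v `stub_cubeZeroToFreeBox`.** On `ℤ³` with free boundary conditions and zero field: if
`θ > 0` is a zero of the cube's characteristic function `θ ↦ ⟨cos(θ M_L)⟩^free_{Λ_L;β,0}`
(`Λ_L = box 3 L`, `M_L = ∑_{x ∈ Λ_L} σ_x`, `0 ≤ β`), then for every `N ≥ L` the larger free box has a
zero `t ∈ (0, θ]` of `t ↦ ⟨cos(t M_L)⟩^free_{Λ_N;β,0}` — Camia–Jiang–Newman 2023 Thm 2 in the volume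
(`exists_zero_isingExpect_cos_of_subset` with `box_mono`).
[cite: CamiaJiangNewman2023, Thm 2, Cor 1 and proof of Thm 2 (§1.2, p. 4)] -/
theorem stub_cubeZeroToFreeBox :
    ∀ (L N : ℕ) (β θ : ℝ), L ≤ N → 0 ≤ β → 0 < θ →
      Literature.Probability.LatticeModels.isingExpect (Literature.Probability.LatticeModels.zdGraph 3)
          (Literature.Probability.LatticeModels.box 3 L) β 0
          Literature.Probability.LatticeModels.BoundaryCondition.free
          (fun σ => Real.cos (θ * ∑ x ∈ Literature.Probability.LatticeModels.box 3 L,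
            Literature.Probability.LatticeModels.spinAt x σ)) = 0 →
      ∃ t : ℝ, 0 < t ∧ t ≤ θ ∧
        Literature.Probability.LatticeModels.isingExpect (Literature.Probability.LatticeModels.zdGraph 3)
          (Literature.Probability.LatticeModels.box 3 N) β 0
          Literature.Probability.LatticeModels.BoundaryCondition.free
          (fun σ => Real.cos (t * ∑ x ∈ Literature.Probability.LatticeModels.box 3 L,
            Literature.Probability.LatticeModels.spinAt x σ)) = 0 := by
  intro L N β θ hLN hβ hθ hzero
  exact exists_zero_isingExpect_cos_of_subset (zdGraph 3) (box_mono 3 hLN) hβ hθ hzero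

end Summit.CriticalPhenomena.Ising3DConformalLimit.LeeYangGapNearCriticalLeeYangGap
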